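import Literature.Analysis.FluidPDE.CheskidovPeriodisedFamily
import HarnessLib

/-!
# Cheskidov's periodisation, III: the force identities

Analysis/FluidPDE support file for the §6 periodisation step of Cheskidov, arXiv:2311.04182
(2023), Thm. 1.3, continuing `CheskidovPeriodisedFamily`. For the family data `D : FamilyData`:

* **Scalar force identity** (6.7): the advection–diffusion residual of the cut-off pair
  `(v₁^m, θ₁^m) = (η̃ v^m, η θ^m)` is `η'(t) θ^m(t)` (`FamilyData.adResidual_v1_theta1`), since
  `η̃ = 1` on `supp η ⊂ (0,2)` where `θ^m` solves `∂ₜθ + v·∇θ = νΔθ`; hence the residual of the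
  periodised pair `(v₂^m, θ₂^m)` is the periodisation of `η' θ^m` (`FamilyData.adResidual_v2_theta2`).
* **Drift force identity**: `∂ₜv₁ + (v₁·∇)v₁ - νΔv₁ = η̃ • (∂ₜv + (v·∇)v - νΔv) + K`,
  `K = η̃' • v + (η̃² - η̃) • (v·∇)v` (`FamilyData.nsBodyForce_v1`), the correction `K^m` being smooth,
  mean zero, zero for `t ≤ 1/2` and `t ≥ 2/3`, and independent of `m ≥ m₁` (stationarity of the
  drifts on `t ≤ 3/4`); and the periodised form (`FamilyData.nsBodyForce_v2`).

## References

* A. Cheskidov, arXiv:2311.04182 (2023), §6, p. 18, (6.6)–(6.7).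
-/

open MeasureTheory Set Filter Topology Function
open scoped InnerProductSpace
open Literature.Analysis.FunctionSpaces (timePeriodize timeWrap timePeriodize_apply)

noncomputable section

namespace Literature.Analysis.FluidPDE

namespace CheskidovPeriodic

/-- The flat two-torus (local notation). [folklore] -/
local notation "𝕋²" => UnitAddTorus (Fin 2)
/-- `ℝ²` (local notation). [folklore] -/
local notation "E²" => EuclideanSpace ℝ (Fin 2)

namespace FamilyData

variable (D : FamilyData)

/-! ## The scalar force identity (6.7) -/

/-- **(6.7) for the cut-off pair**: `∂ₜθ₁ + v₁·∇θ₁ - νΔθ₁ = η'(t) θ^m(t)` at every time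
(Cheskidov 2023, §6, (6.7): `h^m = η'θ̃^m + η(∂ₜθ̃^m + v^m·∇θ̃^m - ν_mΔθ̃^m) = η'θ̃^m`). [cite: Cheskidov2023, (6.7)] -/
theorem adResidual_v1_theta1 (m : ℕ) (s : ℝ) (y : 𝕋²) :
    Torus.adResidual (D.ν m) (D.v1 m) (D.theta1 m) s y = deriv eta s * D.θ m s y := by
  have hθs : ∀ {s}, s ∈ Icc (0 : ℝ) 2 → FunctionSpaces.Torus.IsSmooth (D.θ m s) := fun hs =>
    (D.θ_smooth m).isSmooth_slice hs
  rw [Torus.adResidual_apply]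
  by_cases hs : s ∈ Icc (7 / 10 : ℝ) (13 / 10)
  · -- inside the support window: product rule and the transport equation
    have hs02 : s ∈ Icc (0 : ℝ) 2 := ⟨by linarith [hs.1], by linarith [hs.2]⟩
    have hsint : s ∈ interior (Icc (0 : ℝ) 2) := by
      rw [interior_Icc]; exact ⟨by linarith [hs.1], by linarith [hs.2]⟩
    have hθ1 : FunctionSpaces.Torus.IsContDiff 1 (D.θ m s) := (hθs hs02).isContDiff (by simp)
    have hder := (D.θ_smooth m).hasDerivAt_slice hsint y
    have ht : FunctionSpaces.Torus.timeDerivWithin univ (D.theta1 m) s y =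
        deriv eta s • D.θ m s y + eta s • FunctionSpaces.Torus.timeDerivWithin (Icc 0 2) (D.θ m) s y :=
      Torus.timeDerivWithin_univ_smul hder (hasDerivAt_eta s)
    have hg : FunctionSpaces.Torus.gradient (D.theta1 m s) y = eta s • FunctionSpaces.Torus.gradient (D.θ m s) y := by
      rw [show D.theta1 m s = fun x => eta s * D.θ m s x from rfl, Torus.gradient_const_mul hθ1]
    have hl : FunctionSpaces.Torus.laplacian (D.theta1 m s) y = eta s • FunctionSpaces.Torus.laplacian (D.θ m s) y := by
      rw [show D.theta1 m s = eta s • D.θ m s from rfl, Torus.laplacian_const_smul' (hθs hs02)]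
    have hv : D.v1 m s y = D.v m s y := by
      rw [v1, etaTilde_of_ge (by linarith [hs.1]), one_smul]
    have htr := (D.θ_transport m).transport s hs02 y
    rw [ht, hg, hl, hv, inner_smul_right]
    simp only [smul_eq_mul]
    have : FunctionSpaces.Torus.timeDerivWithin (Icc 0 2) (D.θ m) s y =
        D.ν m * FunctionSpaces.Torus.laplacian (D.θ m s) y -
          ⟪D.v m s y, FunctionSpaces.Torus.gradient (D.θ m s) y⟫_ℝ := by linarith
    rw [this]
    ring
  · -- off the support window: everything vanishes near `s`
    have h0 : ∀ᶠ r in 𝓝 s, eta r = 0 := by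
      filter_upwards [isClosed_Icc.isOpen_compl.mem_nhds hs] with r hr using
        eta_eq_zero fun h' => hr (Ioo_subset_Icc_self h')
    have hzero : D.theta1 m s = fun _ => (0 : ℝ) := by
      funext x; rw [theta1, eta_eq_zero fun h' => hs (Ioo_subset_Icc_self h'), zero_smul]
    have ht : FunctionSpaces.Torus.timeDerivWithin univ (D.theta1 m) s y = 0 := by
      rw [FunctionSpaces.Torus.timeDerivWithin, derivWithin_univ]
      have heq : (fun r => D.theta1 m r y) =ᶠ[𝓝 s] fun _ => (0 : ℝ) :=
        h0.mono fun r hr => by simp only [theta1, hr, zero_smul]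
      rw [heq.deriv_eq, deriv_const]
    rw [ht, hzero, Torus.gradient_zero, Torus.laplacian_zero,
      deriv_eta_eq_zero (Or.inr fun h' => hs (Ioo_subset_Icc_self h'))]
    simp

/-- **(6.7), periodised**: the advection–diffusion residual of `(v₂^m, θ₂^m)` is the
`1`-periodisation of `η' θ^m` (time derivatives commute with the periodisation of fields supported
in the open window, `Torus.timeDerivWithin_timePeriodize`; the other terms are slice-wise). [cite: Cheskidov2023, (6.7)] -/
theorem adResidual_v2_theta2 (m : ℕ) (t : ℝ) (y : 𝕋²) :
    Torus.adResidual (D.ν m) (D.v2 m) (D.theta2 m) t y =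
      timePeriodize (2 / 5) 1 (fun s x => deriv eta s * D.θ m s x) t y := by
  rw [Torus.adResidual_apply, theta2, v2,
    FunctionSpaces.Torus.timeDerivWithin_timePeriodize one_pos (by norm_num) (by norm_num)
      (fun _ ht => D.theta1_eq_zero m ht)]
  simp only [timePeriodize_apply]
  rw [← D.adResidual_v1_theta1 m, Torus.adResidual_apply]

/-! ## The drift force identity -/

/-- The correction `K^m = η̃' • v^m + (η̃² - η̃) • (v^m·∇)v^m` in the body force of the cut-off
drift (supported in `1/2 ≤ t ≤ 2/3`). [folklore] -/
def K (m : ℕ) (t : ℝ) (y : 𝕋²) : E² :=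
  deriv etaTilde t • D.v m t y +
    (etaTilde t ^ 2 - etaTilde t) • FunctionSpaces.Torus.convect (D.v m t) (D.v m t) y

/-- **Body force of the cut-off drift**:
`∂ₜv₁ + (v₁·∇)v₁ - νΔv₁ = η̃ • (∂ₜv + (v·∇)v - νΔv) + K` (product rule in time, bilinearity of
the convective term, linearity of `Δ`). [cite: Cheskidov2023, §6 p. 18] -/
theorem nsBodyForce_v1 (m : ℕ) (s : ℝ) (y : 𝕋²) :
    Torus.nsBodyForce (D.ν m) (D.v1 m) s y =
      etaTilde s • Torus.nsBodyForce (D.ν m) (D.v m) s y + D.K m s y := by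
  have hvs : FunctionSpaces.Torus.IsSmooth (D.v m s) := (D.v_smooth m).isSmooth_slice (mem_univ s)
  have hv1 : FunctionSpaces.Torus.IsContDiff 1 (D.v m s) := hvs.isContDiff (by simp)
  have hder : HasDerivAt (fun r => D.v m r y) (FunctionSpaces.Torus.timeDerivWithin univ (D.v m) s y) s :=
    (D.v_smooth m).hasDerivAt_slice (by simp) y
  have ht : FunctionSpaces.Torus.timeDerivWithin univ (D.v1 m) s y =
      deriv etaTilde s • D.v m s y + etaTilde s • FunctionSpaces.Torus.timeDerivWithin univ (D.v m) s y :=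
    Torus.timeDerivWithin_univ_smul hder (hasDerivAt_etaTilde s)
  have hc : FunctionSpaces.Torus.convect (D.v1 m s) (D.v1 m s) y =
      etaTilde s ^ 2 • FunctionSpaces.Torus.convect (D.v m s) (D.v m s) y := by
    simp only [FunctionSpaces.Torus.convect]
    rw [show D.v1 m s = etaTilde s • D.v m s from rfl, FunctionSpaces.Torus.fderiv_const_smul hv1,
      FunLike.coe_smul, Pi.smul_apply, Pi.smul_apply, map_smul, smul_smul, sq]
  have hl : FunctionSpaces.Torus.laplacian (D.v1 m s) y = etaTilde s • FunctionSpaces.Torus.laplacian (D.v m s) y := by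
    rw [show D.v1 m s = etaTilde s • D.v m s from rfl, Torus.laplacian_const_smul' hvs]
  rw [Torus.nsBodyForce_apply, Torus.nsBodyForce_apply, ht, hc, hl, K]
  module

/-- `K^m(t) = 0` for `t ≥ 2/3` (`η̃ = 1`, `η̃' = 0`). [folklore] -/
theorem K_eq_zero_of_ge (m : ℕ) {t : ℝ} (ht : 2 / 3 ≤ t) : D.K m t = 0 := by
  funext y
  simp [K, deriv_etaTilde_eq_zero (Or.inr ht), etaTilde_of_ge ht]

/-- `K^m(t) = 0` for `t ≤ 1/2` (`η̃ = 0`, `η̃' = 0`). [folklore] -/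
theorem K_eq_zero_of_le (m : ℕ) {t : ℝ} (ht : t ≤ 2⁻¹) : D.K m t = 0 := by
  funext y
  simp [K, deriv_etaTilde_eq_zero (Or.inl ht), etaTilde_of_le ht]

/-- `K^m` is jointly smooth on `ℝ × T²`. [folklore] -/
theorem K_smooth (m : ℕ) : FunctionSpaces.Torus.IsSmoothSpaceTimeOn univ (D.K m) := by
  have h1 : FunctionSpaces.Torus.IsSmoothSpaceTimeOn univ (fun t y => deriv etaTilde t • D.v m t y) :=
    (D.v_smooth m).cutoff (contDiff_infty_iff_deriv.mp contDiff_etaTilde).2 (by simp)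
  have h2 : FunctionSpaces.Torus.IsSmoothSpaceTimeOn univ (fun t y => (etaTilde t ^ 2 - etaTilde t) •
      FunctionSpaces.Torus.convect (D.v m t) (D.v m t) y) :=
    ((D.v_smooth m).convect (D.v_smooth m) uniqueDiffOn_univ).cutoff
      ((contDiff_etaTilde.pow 2).sub contDiff_etaTilde) (by simp)
  exact h1.add h2

/-- `K^m(t)` has zero mean. [folklore] -/
theorem K_zeroMean (m : ℕ) (t : ℝ) : FunctionSpaces.Torus.HasZeroMean (D.K m t) := by
  have hvt : FunctionSpaces.Torus.IsSmooth (D.v m t) := (D.v_smooth m).isSmooth_slice (mem_univ t)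
  unfold FunctionSpaces.Torus.HasZeroMean
  simp only [K]
  rw [integral_add, integral_smul, integral_smul]
  · have h1 : ∫ y, D.v m t y = 0 := D.v_zeroMean m t
    have h2 : ∫ y, FunctionSpaces.Torus.convect (D.v m t) (D.v m t) y = 0 :=
      FunctionSpaces.Torus.integral_fderiv_apply_eq_zero_of_isDivFree hvt hvt (D.v_divFree m t)
    rw [h1, h2, smul_zero, smul_zero, add_zero]
  · exact hvt.integrable.smul (deriv etaTilde t)
  · exact (hvt.convect hvt).integrable.smul (etaTilde t ^ 2 - etaTilde t)

/-- **Stationarity of the correction**: there is `m₁` with `K^m = K^{m₁}` for all `m ≥ m₁`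
(the drifts agree on `t ≤ 3/4` for `m ≥ m₁`, and `K = 0` for `t ≥ 2/3`). [cite: Cheskidov2023, §6 p. 18] -/
theorem K_stationary : ∃ m₁ : ℕ, ∀ m ≥ m₁, D.K m = D.K m₁ := by
  obtain ⟨m₁, hm₁⟩ := D.v_stationary (3 / 4) (by norm_num)
  refine ⟨m₁, fun m hm => ?_⟩
  funext t y
  by_cases ht : t ≤ 3 / 4
  · simp only [K, hm₁ m hm t ht]
  · rw [D.K_eq_zero_of_ge m (by linarith), D.K_eq_zero_of_ge m₁ (by linarith)]

/-- **Body force of the periodised drift**: the `1`-periodisation of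
`η̃ • g^m + K^m`, `g^m = ∂ₜv^m + (v^m·∇)v^m - ν_mΔv^m`. [cite: Cheskidov2023, §6 p. 18] -/
theorem nsBodyForce_v2 (m : ℕ) (t : ℝ) (y : 𝕋²) :
    Torus.nsBodyForce (D.ν m) (D.v2 m) t y =
      timePeriodize (2 / 5) 1
        (fun s x => etaTilde s • Torus.nsBodyForce (D.ν m) (D.v m) s x + D.K m s x) t y := by
  rw [Torus.nsBodyForce_apply, v2,
    FunctionSpaces.Torus.timeDerivWithin_timePeriodize one_pos (by norm_num) (by norm_num)
      (fun _ ht => D.v1_eq_zero m ht)]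
  simp only [timePeriodize_apply]
  rw [← D.nsBodyForce_v1 m, Torus.nsBodyForce_apply]

/-- The body force of the periodised drift is jointly smooth. [folklore] -/
theorem nsBodyForce_v2_smooth (m : ℕ) :
    FunctionSpaces.Torus.IsSmoothSpaceTimeOn univ (Torus.nsBodyForce (D.ν m) (D.v2 m)) := by
  have h := D.v2_smooth m
  have e : Torus.nsBodyForce (D.ν m) (D.v2 m) = fun t y =>
      FunctionSpaces.Torus.timeDerivWithin univ (D.v2 m) t y +
        FunctionSpaces.Torus.convect (D.v2 m t) (D.v2 m t) y - D.ν m • FunctionSpaces.Torus.laplacian (D.v2 m t) y := by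
    funext t y; rfl
  rw [e]
  exact ((h.timeDerivWithin uniqueDiffOn_univ).add (h.convect h uniqueDiffOn_univ)).sub
    ((h.laplacian uniqueDiffOn_univ).const_smul _)

/-- The body force of the periodised drift is `1`-periodic. [folklore] -/
theorem nsBodyForce_v2_periodic (m : ℕ) : Periodic (Torus.nsBodyForce (D.ν m) (D.v2 m)) 1 :=
  Torus.periodic_nsBodyForce (D.v2_periodic m)

/-- The body force of the periodised drift has zero mean at all times. [folklore] -/
theorem nsBodyForce_v2_zeroMean (m : ℕ) (t : ℝ) :
    FunctionSpaces.Torus.HasZeroMean (Torus.nsBodyForce (D.ν m) (D.v2 m) t) :=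
  Torus.hasZeroMean_nsBodyForce (D.v2_smooth m) (D.v2_divFree m) (D.v2_zeroMean m) t

/-- The advection–diffusion residual of `(v₂^m, θ₂^m)` is jointly smooth. [folklore] -/
theorem adResidual_v2_theta2_smooth (m : ℕ) :
    FunctionSpaces.Torus.IsSmoothSpaceTimeOn univ (Torus.adResidual (D.ν m) (D.v2 m) (D.theta2 m)) := by
  have hv := D.v2_smooth m
  have hθ := D.theta2_smooth m
  have e : Torus.adResidual (D.ν m) (D.v2 m) (D.theta2 m) = fun t y =>
      FunctionSpaces.Torus.timeDerivWithin univ (D.theta2 m) t y +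
        ⟪D.v2 m t y, FunctionSpaces.Torus.gradient (D.theta2 m t) y⟫_ℝ -
          D.ν m * FunctionSpaces.Torus.laplacian (D.theta2 m t) y := by
    funext t y; rfl
  rw [e]
  exact ((hθ.timeDerivWithin uniqueDiffOn_univ).add (hv.inner (hθ.gradient uniqueDiffOn_univ))).sub
    ((FunctionSpaces.Torus.isSmoothSpaceTimeOn_const (FunctionSpaces.Torus.isSmooth_const (D.ν m))
      univ).smul (hθ.laplacian uniqueDiffOn_univ))

/-- The residual is `1`-periodic. [folklore] -/
theorem adResidual_v2_theta2_periodic (m : ℕ) :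
    Periodic (Torus.adResidual (D.ν m) (D.v2 m) (D.theta2 m)) 1 := fun t => by
  funext y
  rw [D.adResidual_v2_theta2, D.adResidual_v2_theta2,
    Literature.Analysis.FunctionSpaces.periodic_timePeriodize one_pos _ t]

/-- The residual has zero mean at all times (`∫ η'(s) θ^m(s) = η'(s) ∫ θ^m(s) = 0` for
`s ∈ [0,2]`, and `η'(s) = 0` otherwise). [folklore] -/
theorem adResidual_v2_theta2_zeroMean (m : ℕ) (t : ℝ) :
    FunctionSpaces.Torus.HasZeroMean (Torus.adResidual (D.ν m) (D.v2 m) (D.theta2 m) t) := by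
  have e : Torus.adResidual (D.ν m) (D.v2 m) (D.theta2 m) t =
      fun y => deriv eta (timeWrap (2 / 5) 1 t) * D.θ m (timeWrap (2 / 5) 1 t) y := by
    funext y; rw [D.adResidual_v2_theta2]; rfl
  rw [e]
  set s := timeWrap (2 / 5) 1 t
  unfold FunctionSpaces.Torus.HasZeroMean
  rw [integral_const_mul]
  by_cases hs : s ∈ Icc (0 : ℝ) 2
  · rw [show (∫ y, D.θ m s y) = 0 from D.θ_zeroMean m s hs, mul_zero]
  · rw [deriv_eta_eq_zero (Or.inr fun h => hs ⟨by linarith [h.1], by linarith [h.2]⟩), zero_mul]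

end FamilyData

end CheskidovPeriodic

end Literature.Analysis.FluidPDE

end
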